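/-
Copyright (c) 2026 the pub-hodgecm-mathlib formalisation cell (harness21).  R90-TF SLAB, section S10 (Rogawski 1990, §13.6–13.8 read at `v`),
prover R90-C138-p02 (g2) — DEAL #77 FILE 3 «the (U-BC) letter» (dealer R90-C138-plan (g4) (R22)∕(R27) 2026-09-05T03:38–03:40Z); h413 = `stmt-HodgeConjecture-24833`,
route `HCCMUnconditional`.
-/
import Summits.HodgeConjecture.HodgeConjecture.Theorems.R90S10FrozenDatumDefs      -- ★ C2: `S10FrozenDatum`, `LiesOver`, `Gqs`, `Pl`
import Literature.NumberTheory.Automorphic.IrreducibleClassesUnitarizable            -- ★ `IrrClass.IsUnitarizable`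
import Literature.NumberTheory.Automorphic.LocalUnitaryIntegralLevel                 -- ★ `cmLocalIntegralLevel`
import HarnessLib

/-!
# R90-TF ∕ S10 — THE (U-BC) LETTER `SphericalOverRhoUnitarizableLetter 𝔣`: «at every finite `w ≠ v`, every ADMISSIBLE `U(Φ₃)(𝒪_w)`-spherical class LYING OVER `ρ_w` is UNITARIZABLE»
# (`Theorems/R90S10UnitaryBCLetterDefs.lean`; ns `Summit.HodgeConjecture.HodgeConjecture.R90.S10`; ONE `def … : Prop` + `Iff.rfl`; no instance, no notation, no `sorry` — definition lane)

Print: [Rogawski1990] §13.8 p. 219 L2–L3 («`π_v = ξ_H(ρ_v)` for all `v ≠ w`»), §12.2 pp. 173–174 (the unramified principal series `i_G(χ̃ μ̃)` and its `K`-spherical constituent),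
§13.6 p. 209 («the `t_v` of a unitary `π_v` are bounded»), §10.3 p. 159; §4.9 Lemma 4.9.2 pp. 55–56.  [CartierCorvallis1979] §IV.1 Cor. 4.1–4.2.

## WHY (junction J-t₀-mem, RULINGS (R22)∕(R27))
FILE D reads germs in `EvpGerm S 𝓗 bd σ` at the pins of record — operator bounds and adjoints valid on the fixed vectors of UNITARIZABLE representations (★ `R90S10GermPinsOfRecordDefs`,
★ W1-H4′) — while the (H2♭) road (★ p865075) produces the keystone's `t₀` as eigencharacters of ADMISSIBLE spherical classes `π₀ = ξ_H(ρ_w)` lying over `ρ_w`.  Print: `ξ_H(ρ_w)` is the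
spherical constituent of the UNITARILY induced `i_G(χ̃ μ̃)`, hence unitarizable; the tree has no unitarizability of `cmPrincipalSeries` ∕ `normalizedInd` (rg = 0), so the step is ONE
named local input, (U-BC), the `hUBC` binder of ★-to-be `t₀OfRecord` (`Theorems/R90S10KeystoneT0OfRecord.lean`) TOKEN FOR TOKEN — so that an A-edition sockets
`sock_S10_unitaryBC (𝔣) : SphericalOverRhoUnitarizableLetter 𝔣` and feeds `t₀OfRecord … ((sphericalOverRhoUnitarizableLetter_iff 𝔣).1 (sock_S10_unitaryBC 𝔣))`.  On a cut with
a member the letter is DISCHARGED place by place by rigidity (★ p864906 split ∕ ★ p864959 + ★ p864629 inert, modulo (E1-c)) — road (M) of ★-to-be `t₀OfRecordOfMember`.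
Why it might fail: only if some admissible spherical class lying over `ρ_w` were a non-unitarizable constituent of a non-unitary unramified principal series with the same level
traces as `ρ_w` — excluded in print by `ρ_w` unitary + Lemma 4.9.2 + Cartier Thm. 4.1 (class (E1-c)-local ∕ unitary unramified base change).  A predicate; nothing is asserted.
HONEST LABEL: a definition pays nothing; (U-BC) is ONE new named local residual (counted once); HC_CM is proved only modulo the 7 printed citations (2 remaining named inputs:
hLiu418 = `stmt-HodgeConjecture-24832`, h413 = `stmt-HodgeConjecture-24833`) until rung 0 closes; REL ≠ ★ ≠ BUILT.
-/

set_option autoImplicit false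
set_option linter.dupNamespace false

noncomputable section

open scoped RestrictedProduct Matrix MatrixGroups
open Filter MeasureTheory NumberField IsDedekindDomain CompactlySupported
open Literature.NumberTheory.Rogawski1990 Literature.NumberTheory.Automorphic Literature.NumberTheory.Automorphic.UnitaryGroup
open Literature.NumberTheory.Automorphic.UnitaryGroup.CotangentForms Literature.NumberTheory.GaloisRepresentations
open Literature.NumberTheory.Automorphic.Arthur2013.Leaves.TECR
open Summit.HodgeConjecture.HodgeConjecture.Cruxes.H413
open Summit.HodgeConjecture.HodgeConjecture.Cruxes.H413.K2E1TraceFormulaBeta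
open Summit.HodgeConjecture.HodgeConjecture.Cruxes.H413.K2E1SpectralTermsDiscreteHalf

namespace Summit.HodgeConjecture.HodgeConjecture.R90.S10

section Frozen

variable {L : Type} [Field L] [NumberField L] [IsCMField L] [DecidableEq (Pl L)] {μ : HeckeCharacter L} {v : Pl L}
  [MeasurableSpace (HLoc L v)] [BorelSpace (HLoc L v)] [MeasurableSpace (Gqs L v)] [BorelSpace (Gqs L v)]
  {νHv : Measure (HLoc L v)} {νQv : Measure (Gqs L v)} [νHv.IsHaarMeasure] [νHv.IsMulRightInvariant] [νQv.IsHaarMeasure] [νQv.IsMulRightInvariant]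
  [∀ a : HLoc L v, MeasurableSpace (HLoc L v ⧸ Subgroup.centralizer ({a} : Set (HLoc L v)))]
  [∀ a : HLoc L v, BorelSpace (HLoc L v ⧸ Subgroup.centralizer ({a} : Set (HLoc L v)))]
  [∀ γ : Gqs L v, MeasurableSpace (Gqs L v ⧸ Subgroup.centralizer ({γ} : Set (Gqs L v)))]
  [∀ γ : Gqs L v, BorelSpace (Gqs L v ⧸ Subgroup.centralizer ({γ} : Set (Gqs L v)))]
  {mHv : OrbitalMeasureFamily (HLoc L v)} {mQv : OrbitalMeasureFamily (Gqs L v)} {πSt : IrrClass (HLoc L v)}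
  [MeasurableSpace (G3 L).Adelic] [BorelSpace (G3 L).Adelic] [MeasurableSpace (H2 L).Adelic] [BorelSpace (H2 L).Adelic]
  [MeasurableSpace (GArch L)] [BorelSpace (GArch L)] [MeasurableSpace (HArch L)] [BorelSpace (HArch L)]
  [MeasurableSpace (H1Loc L v)] [MeasurableSpace (H1Arch L)] [MeasurableSpace (H1 L).Adelic] [BorelSpace (H1 L).Adelic]

/-- **(U-BC) `SphericalOverRhoUnitarizableLetter 𝔣` — «EVERY ADMISSIBLE `U(Φ₃)(𝒪_w)`-SPHERICAL CLASS LYING OVER `ρ_w` IS UNITARIZABLE», at every finite `w ≠ v` of the frozen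
datum** (the `hUBC` binder of `t₀OfRecord` TOKEN FOR TOKEN): `∀ (w : {w // w ≠ v}) (π : IrrClass (Gqs L w.1)), π.IsAdmissible → π.IsSpherical (U(Φ₃)(𝒪_w)) → LiesOver … π (𝔥.ρ w.1) →
π.IsUnitarizable`.  Print: such a `π` is `ξ_H(ρ_w)`, the spherical constituent of the unitarily induced `i_G(χ̃ μ̃)` [§12.2; Lemma 4.9.2; Cartier Thm. 4.1].  A predicate; nothing is
asserted. [cite: Rogawski1990, §13.8 p. 219 L2–L3; §12.2 pp. 173–174; §13.6 p. 209] [cite: CartierCorvallis1979, §IV.1 Cor. 4.1–4.2] -/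
def SphericalOverRhoUnitarizableLetter (𝔣 : S10FrozenDatum L μ v νHv νQv mHv mQv πSt) : Prop :=
  ∀ (w : {w : Pl L // w ≠ v}) (π : IrrClass (Gqs L w.1)), π.IsAdmissible → π.IsSpherical (cmLocalIntegralLevel L 3 (qsForm L) w.1) →
    LiesOver L μ w.1 (𝔣.𝔳.K w.1) (𝔣.𝔥.KH w.1) (𝔣.𝔳.νQ w) (𝔣.𝔳.νHw w) (𝔣.𝔳.mH w) (𝔣.𝔳.mQ w) π (𝔣.𝔥.ρ w.1) → π.IsUnitarizable

/-- Unfolding (U-BC), `Iff.rfl`. [cite: Rogawski1990, §13.8 p. 219 L2–L3] -/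
theorem sphericalOverRhoUnitarizableLetter_iff (𝔣 : S10FrozenDatum L μ v νHv νQv mHv mQv πSt) :
    SphericalOverRhoUnitarizableLetter 𝔣 ↔
      ∀ (w : {w : Pl L // w ≠ v}) (π : IrrClass (Gqs L w.1)), π.IsAdmissible → π.IsSpherical (cmLocalIntegralLevel L 3 (qsForm L) w.1) →
        LiesOver L μ w.1 (𝔣.𝔳.K w.1) (𝔣.𝔥.KH w.1) (𝔣.𝔳.νQ w) (𝔣.𝔳.νHw w) (𝔣.𝔳.mH w) (𝔣.𝔳.mQ w) π (𝔣.𝔥.ρ w.1) → π.IsUnitarizable :=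
  Iff.rfl

end Frozen

end Summit.HodgeConjecture.HodgeConjecture.R90.S10

end
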